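import Mathlib.NumberTheory.AbelSummation
import Mathlib.NumberTheory.Chebyshev
import Literature.NumberTheory.LFunctions.WeilMarkovQuadratic
import HarnessLib

/-!
# rh-explicit (venture WeilGRH): THE FLAT PRIME SUM OF A WINDOW IS AT MOST `c·(2(eᵃ − 1)/a − 1)` WHENEVER
  `ψ(t) ≤ c·t` — Abel summation with the weight `t^{-1/2}(1 − log t/2a)`

Cell `rh-explicit`, WEIL TRACK (structure seat weil-3, gen11).  Hypothesis-parametric, RH-free real analysis.
The flat prime sum of the window `[-a, a]`,

  `S(a) = Σ_{log n < 2a} Λ(n) n^{-1/2} (1 − log n/(2a))`,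

is the only arithmetic quantity in the phase-blind window budget (`ZetaWindowPhaseBlind`); the tree so far bounds
it by `Λ(n) ≤ 2a`, `Σn^{-1/2} ≤ 2eᵃ`, i.e. `2S(a) ≤ 8a·eᵃ` (`WindowBudgetGoldstonGonek.flatBudget_le`), which is what
makes the typed explicit multiplicity bound (`ZetaMultiplicityBound.two_mul_mul_zetaZeroOrder_le_explicit`) weaker
than Simonič's `1.92 log γ/log log γ` at every height (weil-grh-5, GRH-LIT-AS-PRINTED A52 addendum).  With a
Chebyshev bound `ψ(t) ≤ c·t` the weight `(1 − log n/2a)` gains the factor `1/a`: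

* `hasDerivAt_flatWeight`: `d/dt[(1 − log t/L)/√t] = −(1/L + (1 − log t/L)/2)/(t√t)` (`t > 0`);
* `hasDerivAt_flatWeightPrim`: `d/dt[√t(1 − log t/L + 4/L)] = (1/L + (1 − log t/L)/2)/√t` (`t > 0`);
* `flatSum_eq_sum_Icc`: `S(a) = Σ_{k ≤ ⌊e^{2a}⌋} Λ(k)(1 − log k/2a)/√k` (the window's strict inequality costs nothing:
  the weight vanishes at `n = e^{2a}`);
* **`flatSum_le_of_psi_le`**: if `ψ(t) ≤ c·t` for all `t ≥ 0`, then for every `a > 0`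

    `Σ_{log n < 2a} Λ(n) n^{-1/2}(1 − log n/(2a)) ≤ c·(2(eᵃ − 1)/a − 1)`

  (Abel: `S(a) = −∫₁^{e^{2a}} ψ(t)·w′(t)dt`, `−w′ ≥ 0` on `[1, e^{2a}]`, `∫₁^{e^{2a}} t(−w′) = 2(eᵃ−1)/a − 1`).

Under RH `ψ(t) ≤ 1.04·t` for all `t ≥ 0` (`SchoenfeldPsiTheta`: Rosser–Schoenfeld Thm 12 + Schoenfeld 1976), so
`2S(a) ≤ 2.08·(2(eᵃ − 1)/a − 1)`; with the phase-blind budget at the window `a = log log γ` this gives the explicit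
all-height multiplicity bound `ord_{½+iγ}ζ ≤ (½ + 2.08/log log γ)·log γ/log log γ` (`ZetaMultiplicityExplicit.lean`).

No definitions, no named facts; RH-free (the Chebyshev bound is a hypothesis).
-/

set_option autoImplicit false

noncomputable section

open Finset MeasureTheory
open scoped Real Topology Chebyshev ArithmeticFunction.vonMangoldt

namespace Summit.Ventures.WeilGRH

open Literature.NumberTheory.LFunctions

/-! ## The weight `w(t) = (1 − log t/L)/√t` and a primitive of `t ↦ t·(−w′(t))` -/

/-- `w′(t) = −(1/L + (1 − log t/L)/2)/(t√t)` for `t > 0`. -/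
theorem hasDerivAt_flatWeight (L : ℝ) {t : ℝ} (ht : 0 < t) :
    HasDerivAt (fun s : ℝ ↦ (1 - Real.log s / L) / Real.sqrt s)
      (-((1 / L + (1 - Real.log t / L) / 2) / (t * Real.sqrt t))) t := by
  have hs : 0 < Real.sqrt t := Real.sqrt_pos.2 ht
  have h1 : HasDerivAt (fun s : ℝ ↦ 1 - Real.log s / L) (-(t⁻¹ / L)) t := by
    simpa using ((Real.hasDerivAt_log ht.ne').div_const L).const_sub 1
  have h2 : HasDerivAt (fun s : ℝ ↦ Real.sqrt s) (1 / (2 * Real.sqrt t)) t := Real.hasDerivAt_sqrt ht.ne'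
  have h := h1.div h2 hs.ne'
  refine h.congr_deriv ?_
  have hss2 : Real.sqrt t ^ 2 = t := Real.sq_sqrt ht.le
  field_simp
  rw [hss2]
  ring

/-- `d/dt[√t·(1 − log t/L + 4/L)] = (1/L + (1 − log t/L)/2)/√t` for `t > 0`. -/
theorem hasDerivAt_flatWeightPrim (L : ℝ) {t : ℝ} (ht : 0 < t) :
    HasDerivAt (fun s : ℝ ↦ Real.sqrt s * (1 - Real.log s / L + 4 / L))
      ((1 / L + (1 - Real.log t / L) / 2) / Real.sqrt t) t := by
  have h1 : HasDerivAt (fun s : ℝ ↦ 1 - Real.log s / L + 4 / L) (-(t⁻¹ / L)) t := by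
    simpa using (((Real.hasDerivAt_log ht.ne').div_const L).const_sub 1).add_const (4 / L)
  have h2 : HasDerivAt (fun s : ℝ ↦ Real.sqrt s) (1 / (2 * Real.sqrt t)) t := Real.hasDerivAt_sqrt ht.ne'
  have h := h2.mul h1
  refine h.congr_deriv ?_
  have hss2 : Real.sqrt t ^ 2 = t := Real.sq_sqrt ht.le
  field_simp
  rw [hss2]
  ring

/-! ## The window sum as a sum over `k ≤ ⌊e^{2a}⌋` -/

/-- **`S(a) = Σ_{k ≤ ⌊e^{2a}⌋} Λ(k)·(1 − log k/2a)/√k`**: the members of `range(⌊e^{2a}⌋+1)` with `log n ≥ 2a` are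
`n = e^{2a}` only, where the weight vanishes. -/
theorem flatSum_eq_sum_Icc {a : ℝ} (ha : 0 < a) :
    ∑ n ∈ weilPrimeIndex a, (Λ n : ℝ) / Real.sqrt n * (1 - Real.log n / (2 * a)) =
      ∑ k ∈ Icc 0 ⌊Real.exp (2 * a)⌋₊, (1 - Real.log k / (2 * a)) / Real.sqrt k * (Λ k : ℝ) := by
  unfold weilPrimeIndex
  rw [Finset.sum_filter, Nat.range_succ_eq_Icc_zero]
  refine Finset.sum_congr rfl fun k hk ↦ ?_
  split_ifs with h
  · ring
  · rcases Nat.eq_zero_or_pos k with rfl | hk0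
    · simp
    · have hkx : (k : ℝ) ≤ Real.exp (2 * a) :=
        (Nat.le_floor_iff (Real.exp_pos _).le).1 (Finset.mem_Icc.1 hk).2
      have hlog : Real.log k ≤ 2 * a := by
        have := Real.log_le_log (by exact_mod_cast hk0) hkx
        rwa [Real.log_exp] at this
      have heq : Real.log k = 2 * a := le_antisymm hlog (not_lt.1 h)
      rw [heq, div_self (by linarith), sub_self, zero_div, zero_mul]

/-! ## Abel summation against a Chebyshev bound -/

/-- **THE FLAT PRIME SUM AGAINST A CHEBYSHEV BOUND**: if `ψ(t) ≤ c·t` for every `t ≥ 0`, then for every `a > 0`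

  `Σ_{log n < 2a} Λ(n) n^{-1/2} (1 − log n/(2a)) ≤ c·(2(eᵃ − 1)/a − 1)`.

(Abel summation with `w(t) = (1 − log t/2a)/√t`, `w(e^{2a}) = 0`: `S(a) = ∫₁^{e^{2a}} ψ(t)(−w′(t))dt ≤ c∫₁^{e^{2a}} t(−w′(t))dt`,
and `t(−w′(t))` has the primitive `√t(1 − log t/2a + 2/a)`.)  Under RH `c = 1.04` (Rosser–Schoenfeld). -/
theorem flatSum_le_of_psi_le {c : ℝ} (hψ : ∀ t : ℝ, 0 ≤ t → ψ t ≤ c * t) {a : ℝ} (ha : 0 < a) :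
    ∑ n ∈ weilPrimeIndex a, (Λ n : ℝ) / Real.sqrt n * (1 - Real.log n / (2 * a)) ≤
      c * (2 * (Real.exp a - 1) / a - 1) := by
  rw [flatSum_eq_sum_Icc ha]
  set L : ℝ := 2 * a with hL
  set x : ℝ := Real.exp L with hx
  have hL0 : 0 < L := by rw [hL]; linarith
  have hx1 : 1 ≤ x := by rw [hx]; exact Real.one_le_exp (by linarith)
  have hlogx : Real.log x = L := by rw [hx, Real.log_exp]
  have hsqrtx : Real.sqrt x = Real.exp a := by
    rw [hx, hL, show 2 * a = a + a by ring, Real.exp_add, Real.sqrt_mul_self (Real.exp_pos a).le]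
  -- the weight, its derivative, and the primitive of `t(−w′)`
  set w : ℝ → ℝ := fun s ↦ (1 - Real.log s / L) / Real.sqrt s with hw
  set w' : ℝ → ℝ := fun t ↦ -((1 / L + (1 - Real.log t / L) / 2) / (t * Real.sqrt t)) with hw'
  set G : ℝ → ℝ := fun s ↦ Real.sqrt s * (1 - Real.log s / L + 4 / L) with hG
  have hderiv : ∀ t : ℝ, 0 < t → HasDerivAt w (w' t) t := fun t ht ↦ hasDerivAt_flatWeight L ht
  have hdiff : ∀ t ∈ Set.Icc 1 x, DifferentiableAt ℝ w t :=
    fun t ht ↦ (hderiv t (by linarith [ht.1])).differentiableAt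
  have hderiv_eq : ∀ t : ℝ, 0 < t → deriv w t = w' t := fun t ht ↦ (hderiv t ht).deriv
  -- continuity of `w'` and `G'` on `(0, ∞)`
  have hcontAt : ∀ t : ℝ, 0 < t → ContinuousAt w' t ∧
      ContinuousAt (fun s : ℝ ↦ (1 / L + (1 - Real.log s / L) / 2) / Real.sqrt s) t := by
    intro t ht
    have h1 : ContinuousAt Real.log t := Real.continuousAt_log ht.ne'
    have h2 : ContinuousAt Real.sqrt t := Real.continuous_sqrt.continuousAt
    have hnum : ContinuousAt (fun s : ℝ ↦ 1 / L + (1 - Real.log s / L) / 2) t :=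
      continuousAt_const.add ((continuousAt_const.sub (h1.div_const L)).div_const 2)
    have hs0 : Real.sqrt t ≠ 0 := (Real.sqrt_pos.2 ht).ne'
    exact ⟨(hnum.div (continuousAt_id.mul h2) (mul_ne_zero ht.ne' hs0)).neg, hnum.div h2 hs0⟩
  have hcont : ContinuousOn w' (Set.Icc 1 x) :=
    fun t ht ↦ ((hcontAt t (by linarith [ht.1])).1).continuousWithinAt
  have hint' : IntegrableOn w' (Set.Icc 1 x) := hcont.integrableOn_Icc
  have hint : IntegrableOn (deriv w) (Set.Icc 1 x) :=
    hint'.congr_fun (fun t ht ↦ (hderiv_eq t (by linarith [ht.1])).symm) measurableSet_Icc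
  -- Abel summation
  have habel := sum_mul_eq_sub_integral_mul₀ (fun k ↦ (Λ k : ℝ)) (by simp) x hdiff hint
  have hS : (∑ k ∈ Icc 0 ⌊x⌋₊, (1 - Real.log k / L) / Real.sqrt k * (Λ k : ℝ)) =
      ∑ k ∈ Icc 0 ⌊x⌋₊, w k * (Λ k : ℝ) := rfl
  have hwx : w x = 0 := by
    show (1 - Real.log x / L) / Real.sqrt x = 0
    rw [hlogx, div_self hL0.ne', sub_self, zero_div]
  rw [hS, habel, hwx, zero_mul, zero_sub]
  -- the integral is `∫ w'·ψ` over `(1, x]`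
  have hI : ∫ t in Set.Ioc 1 x, deriv w t * ∑ k ∈ Icc 0 ⌊t⌋₊, (Λ k : ℝ) =
      ∫ t in Set.Ioc 1 x, w' t * ψ t :=
    setIntegral_congr_fun measurableSet_Ioc fun t ht ↦ by
      rw [hderiv_eq t (by linarith [ht.1]), Chebyshev.psi_eq_sum_Icc]
  rw [hI, ← integral_neg]
  -- integrability of the two integrands on `(1, x]`
  have hIψ : IntegrableOn (fun t : ℝ ↦ w' t * ψ t) (Set.Ioc 1 x) := by
    have h := (integrableOn_mul_sum_Icc (fun k ↦ (Λ k : ℝ)) (m := 0) zero_le_one hint').mono_set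
      Set.Ioc_subset_Icc_self
    exact h.congr_fun (fun t _ ↦ by rw [Chebyshev.psi_eq_sum_Icc]) measurableSet_Ioc
  have hGcont : ContinuousOn (fun s : ℝ ↦ (1 / L + (1 - Real.log s / L) / 2) / Real.sqrt s) (Set.Icc 1 x) :=
    fun t ht ↦ ((hcontAt t (by linarith [ht.1])).2).continuousWithinAt
  have hIc : IntegrableOn (fun t : ℝ ↦ c * ((1 / L + (1 - Real.log t / L) / 2) / Real.sqrt t)) (Set.Ioc 1 x) :=
    (hGcont.integrableOn_Icc.mono_set Set.Ioc_subset_Icc_self).const_mul c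
  -- pointwise: `−w'(t)ψ(t) ≤ c·(−w'(t))·t = c·G'(t)` on `(1, x]`
  have hpt : ∀ t ∈ Set.Ioc 1 x, -(w' t * ψ t) ≤ c * ((1 / L + (1 - Real.log t / L) / 2) / Real.sqrt t) := by
    intro t ht
    have ht0 : 0 < t := by linarith [ht.1]
    have hs : 0 < Real.sqrt t := Real.sqrt_pos.2 ht0
    have hlogt : Real.log t ≤ L := by rw [← hlogx]; exact Real.log_le_log ht0 ht.2
    have hnum : 0 ≤ 1 / L + (1 - Real.log t / L) / 2 := by
      have : 0 ≤ 1 - Real.log t / L := by rw [sub_nonneg, div_le_one hL0]; exact hlogt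
      positivity
    have hK : 0 ≤ (1 / L + (1 - Real.log t / L) / 2) / (t * Real.sqrt t) := by positivity
    have hψt := hψ t ht0.le
    have hψ0 := Chebyshev.psi_nonneg t
    have e1 : -(w' t * ψ t) = (1 / L + (1 - Real.log t / L) / 2) / (t * Real.sqrt t) * ψ t := by
      rw [hw']; ring
    have e2 : c * ((1 / L + (1 - Real.log t / L) / 2) / Real.sqrt t) =
        (1 / L + (1 - Real.log t / L) / 2) / (t * Real.sqrt t) * (c * t) := by
      field_simp
    rw [e1, e2]
    exact mul_le_mul_of_nonneg_left hψt hK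
  have hmono : ∫ t in Set.Ioc 1 x, -(w' t * ψ t) ≤
      ∫ t in Set.Ioc 1 x, c * ((1 / L + (1 - Real.log t / L) / 2) / Real.sqrt t) :=
    setIntegral_mono_on hIψ.neg hIc measurableSet_Ioc hpt
  refine hmono.trans (le_of_eq ?_)
  -- evaluate `∫₁^x c·G' = c·(G(x) − G(1)) = c·(2(eᵃ − 1)/a − 1)`
  have hGcont' : ContinuousOn (fun s : ℝ ↦ (1 / L + (1 - Real.log s / L) / 2) / Real.sqrt s) (Set.uIcc 1 x) := by
    rwa [Set.uIcc_of_le hx1]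
  have hFTC : ∫ t in Set.Ioc 1 x, (1 / L + (1 - Real.log t / L) / 2) / Real.sqrt t = G x - G 1 := by
    rw [← intervalIntegral.integral_of_le hx1]
    refine intervalIntegral.integral_eq_sub_of_hasDerivAt (fun t ht ↦ hasDerivAt_flatWeightPrim L ?_)
      hGcont'.intervalIntegrable
    rw [Set.uIcc_of_le hx1] at ht
    linarith [ht.1]
  have hGval : G x - G 1 = 2 * (Real.exp a - 1) / a - 1 := by
    show Real.sqrt x * (1 - Real.log x / L + 4 / L) - Real.sqrt 1 * (1 - Real.log 1 / L + 4 / L) =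
      2 * (Real.exp a - 1) / a - 1
    rw [hsqrtx, hlogx, Real.sqrt_one, Real.log_one, hL]
    field_simp
    ring
  rw [integral_const_mul, hFTC, hGval]

end Summit.Ventures.WeilGRH

end
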